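import Mathlib
import Literature.AlgebraicGeometry.Resolution.AlterationsSingularComponents
import Summits.ResolutionOfSingularities.ResolutionOfSingularities.Theorems.FrobeniusLadderFRationalResolutionCompletionOfFlatUnramifiedAtPrime

/-!
# Crux `FrobeniusLadder.FRationalResolution` (stmt-ResolutionOfSingularities-15317), line `redirect`,
# stub `stub_diagonalizableQuotientResolution` — THE RING ENGINE OF THE TRANSPORT STEP (T):
# local rings of a base change `C ⊗_A B` along a «formally bijective» `A → B` (`B/𝔪B = A/𝔪`, e.g. `B = Â`)
# have THE SAME COMPLETIONS as those of `C` at primes over `V(𝔪)`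

Item (T) of MEMO-15317-leafhand2-g18 §2c / MEMO-15317-leafhand2-g22 §3 (F3): the two-step and class-group recipes at a
twisted isolated point compute a blowing up `X₁' = Bl_J(Spec T)` on a MODEL `T` (the toric chart ring, or `B_𝔮`) and must
read off the singular points `z` of `X₁ = Bl_{J Ê}(Spec Ê) = X₁' ×_T Ê` over `V(𝔪̂)` together with their complete local
rings `𝒪̂_{X₁,z} ≅ 𝒪̂_{X₁',z'}` (the inputs of `…MaximalIdealTower.hloc_of_maximalIdealPow_then_singularPoints`,
`…IntrinsicRecipeFinite`, `…PointBlowupOfCompletion.isRegular_affineBlowup_maximalIdeal_of_ringEquiv_adicCompletion`).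
`…CompletionOfFlatUnramified(AtPrime)` (p838948 era) proves `Â' ≅ B̂'` for a flat local homomorphism that is UNRAMIFIED
with TRIVIAL RESIDUE EXTENSION — as hypotheses. This file DERIVES those hypotheses for the base change: for commutative
rings `A → B` with `B` faithfully flat over `A` and `B = A + 𝔪B` for an ideal `𝔪 ⊆ A` (e.g. `B = Â`, `𝔪 = 𝔪_A`, `A`
Noetherian local), an `A`-algebra `C` (a chart ring of the blowing up, or a local ring of it) and a prime `𝔫 ⊇ 𝔪C` of `C`:
* `map_map_includeRight_le` / `tmul_mem_map_of_mem` — `C ⊗ 𝔪B ⊆ 𝔫·(C ⊗_A B)`;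
* ★ `exists_sub_algebraMap_mem` — **`C ⊗_A B = C ⊗ 1 + 𝔫·(C ⊗_A B)`**: every element is `≡ c ⊗ 1` modulo `𝔫 (C ⊗_A B)`;
* `comap_map_eq` — `𝔫 (C ⊗_A B) ∩ C = 𝔫` (faithful flatness of the base change);
* ★ `isPrime_map` — **`𝔫 (C ⊗_A B)` is a PRIME ideal** (its quotient is `C/𝔫`);
* ★ `eq_map_of_comap_eq` / `existsUnique_isPrime_comap_eq` — **it is the UNIQUE prime of `C ⊗_A B` over `𝔫`** (the fibre of
  `Spec (C ⊗_A B) → Spec C` over a point of `V(𝔪C)` is one point with the same residue field);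
* `forall_exists_sub_localRingHom_mem_of_prime` — the residue condition LOCALISES at a prime (general lemma: `R → S`,
  `P` over `p`, `S = f(R) + P` ⇒ every element of `S_P` is `≡ ℓ(c) mod 𝔪_{S_P}`, `ℓ = Localization.localRingHom`; the
  tree's `…CompletionOfFlatUnramifiedAtPrime.forall_exists_sub_localRingHom_mem` needed `P` maximal);
* `map_eq_maximalIdeal_localization` — unramified: `𝔫 · (C ⊗_A B)_𝔑 = 𝔪_{(C ⊗_A B)_𝔑}`;
* ★★ **`exists_ringEquiv_adicCompletion`** — for every prime `𝔑` of `C ⊗_A B` over `𝔫`: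
  **`(C_𝔫)^ ≃+* ((C ⊗_A B)_𝔑)^`** over `ℓ` (flat + unramified + residue-trivial, then the engine
  `…CompletionOfFlatUnramified.exists_ringEquiv_adicCompletion_of_flat`);
* ★★ `forall_exists_sub_mem_adicCompletion` / `existsUnique_isPrime_comap_eq_adicCompletion` — the case `B = Â`,
  `𝔪 = 𝔪_A` for a Noetherian local `A` (Mathlib: `Â` flat hence faithfully flat by `Module.FaithfullyFlat.of_flat_of_isLocalHom`,
  `𝔪_Â = 𝔪_A Â`, `κ(A) = κ(Â)`): the hypothesis `hres` holds for `Â`, so **for every `A`-algebra `C` and prime `𝔫 ⊇ 𝔪_A C`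
  there is a unique prime `𝔑` of `C ⊗_A Â` over `𝔫`**, and `exists_ringEquiv_adicCompletion (maximalIdeal A)
  (forall_exists_sub_mem_adicCompletion A)` gives `((C ⊗_A Â)_𝔑)^ ≅ (C_𝔫)^` (apply it inside the consumer's proof; a
  stand-alone restatement for `B = Â` makes instance search on `Localization.AtPrime 𝔑` diverge — Lean note).
* ★★ §6 (appended): `isRegularLocalRing_iff` — Noetherian case: **`C_𝔫` regular iff `(C ⊗_A B)_𝔑` regular** (regularity
  is decided by the completion); `comap_bijOn` — `Spec (C ⊗_A B) → Spec C` is a BIJECTION over `V(𝔪C)`; ★★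
  `comap_bijOn_not_isRegularLocalRing` / `finite_not_isRegularLocalRing_of_finite` — the NON-REGULAR primes over `V(𝔪)`
  correspond, so «finitely many singular points over `V(𝔪̂)`» (input of the two-step recipes) is read off on the model.
With `C` a Rees chart algebra `A[J/a]` of `Bl_J(Spec A)` (so that `C ⊗_A Â = Â[JÂ/a]` is the chart algebra of
`Bl_{JÂ}(Spec Â)`, tree `…BlowupCartierBaseChange`) this is the point-and-completion correspondence over `V(𝔪)` between
`Bl_J(Spec A)` and `Bl_{JÂ}(Spec Â)`; what remains of (T) is the scheme-side identification of `𝒪_{X₁,z}` with such a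
localization (chartwise), not done here.

Honest label: ring-level plumbing toward ONE leaf stub (no stub, crux or summit closed). No definitions, no named facts,
no sorry. [cite: Matsumura1987, Thm. 8.4; Thm. 8.14; Thm. 22.4 (i); §19 p. 158] [cite: StacksProject, Tag 0C4G; Tag 02G8;
Tag 05GG] [folklore]
-/

noncomputable section

-- single-problem summit: the doubled namespace component is forced
set_option linter.dupNamespace false

open IsLocalRing AlgebraicGeometry
open scoped TensorProduct
open Literature.AlgebraicGeometry.Resolution

namespace Summit.ResolutionOfSingularities.ResolutionOfSingularities.Theorems.FRationalResolution.CompletedBaseChangeFibre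

variable {A B C : Type} [CommRing A] [CommRing B] [CommRing C] [Algebra A B] [Algebra A C]

/-! ## §1 `C ⊗ 𝔪B ⊆ 𝔫 (C ⊗_A B)` and `C ⊗_A B = C ⊗ 1 + 𝔫 (C ⊗_A B)` -/

/-- `1 ⊗ (𝔪B) ⊆ 𝔫 · (C ⊗_A B)` when `𝔪 C ⊆ 𝔫`: indeed `1 ⊗ φ_B(a) = φ_C(a) ⊗ 1`. [folklore] -/
theorem map_map_includeRight_le (𝔪 : Ideal A) (𝔫 : Ideal C) (h𝔫 : 𝔪.map (algebraMap A C) ≤ 𝔫) :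
    (𝔪.map (algebraMap A B)).map
        ((Algebra.TensorProduct.includeRight (R := A) (A := C) (B := B)).toRingHom) ≤
      𝔫.map (algebraMap C (C ⊗[A] B)) := by
  rw [Ideal.map_le_iff_le_comap, Ideal.map_le_iff_le_comap]
  intro a ha
  rw [Ideal.mem_comap, Ideal.mem_comap, AlgHom.toRingHom_eq_coe, AlgHom.coe_toRingHom,
    Algebra.TensorProduct.includeRight_apply, ← Algebra.TensorProduct.tmul_one_eq_one_tmul]
  have h1 : algebraMap A C a ⊗ₜ[A] (1 : B) = algebraMap C (C ⊗[A] B) (algebraMap A C a) := by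
    rw [Algebra.TensorProduct.algebraMap_apply, Algebra.algebraMap_self_apply]
  rw [h1]
  exact Ideal.mem_map_of_mem _ (h𝔫 (Ideal.mem_map_of_mem _ ha))

/-- `c ⊗ m ∈ 𝔫 · (C ⊗_A B)` for `m ∈ 𝔪B`, `𝔪C ⊆ 𝔫`. [folklore] -/
theorem tmul_mem_map_of_mem (𝔪 : Ideal A) (𝔫 : Ideal C) (h𝔫 : 𝔪.map (algebraMap A C) ≤ 𝔫) (c : C)
    {m : B} (hm : m ∈ 𝔪.map (algebraMap A B)) :
    c ⊗ₜ[A] m ∈ 𝔫.map (algebraMap C (C ⊗[A] B)) := by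
  have h1 : (1 : C) ⊗ₜ[A] m ∈ 𝔫.map (algebraMap C (C ⊗[A] B)) := by
    have := map_map_includeRight_le (B := B) 𝔪 𝔫 h𝔫 (Ideal.mem_map_of_mem _ hm)
    rwa [AlgHom.toRingHom_eq_coe, AlgHom.coe_toRingHom, Algebra.TensorProduct.includeRight_apply] at this
  have h2 : c ⊗ₜ[A] m = (c ⊗ₜ[A] (1 : B)) * ((1 : C) ⊗ₜ[A] m) := by
    rw [Algebra.TensorProduct.tmul_mul_tmul, mul_one, one_mul]
  rw [h2]
  exact Ideal.mul_mem_left _ _ h1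

/-- ★ **`C ⊗_A B = C ⊗ 1 + 𝔫 · (C ⊗_A B)`**: if `B = φ(A) + 𝔪B` and `𝔪C ⊆ 𝔫`, every element of `C ⊗_A B` is congruent
to some `c ⊗ 1` modulo `𝔫 (C ⊗_A B)` (on pure tensors `c ⊗ b = (a•c) ⊗ 1 + c ⊗ (b - φ a)`).
[cite: Matsumura1987, Thm. 8.14] [folklore] -/
theorem exists_sub_algebraMap_mem (𝔪 : Ideal A)
    (hres : ∀ b : B, ∃ a : A, b - algebraMap A B a ∈ 𝔪.map (algebraMap A B))
    (𝔫 : Ideal C) (h𝔫 : 𝔪.map (algebraMap A C) ≤ 𝔫) :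
    ∀ x : C ⊗[A] B, ∃ c : C, x - algebraMap C (C ⊗[A] B) c ∈ 𝔫.map (algebraMap C (C ⊗[A] B)) := by
  intro x
  induction x using TensorProduct.induction_on with
  | zero => exact ⟨0, by rw [map_zero, sub_zero]; exact Ideal.zero_mem _⟩
  | tmul c b =>
    obtain ⟨a, ha⟩ := hres b
    have key : c ⊗ₜ[A] algebraMap A B a = algebraMap C (C ⊗[A] B) (a • c) := by
      rw [Algebra.TensorProduct.algebraMap_apply, Algebra.algebraMap_self_apply,
        Algebra.algebraMap_eq_smul_one, TensorProduct.tmul_smul, TensorProduct.smul_tmul']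
    refine ⟨a • c, ?_⟩
    rw [← key, ← TensorProduct.tmul_sub]
    exact tmul_mem_map_of_mem 𝔪 𝔫 h𝔫 c ha
  | add x y hx hy =>
    obtain ⟨c₁, h₁⟩ := hx
    obtain ⟨c₂, h₂⟩ := hy
    refine ⟨c₁ + c₂, ?_⟩
    rw [map_add, add_sub_add_comm]
    exact Ideal.add_mem _ h₁ h₂

/-! ## §2 `𝔫 (C ⊗_A B)` is the unique prime over `𝔫` -/

/-- `𝔫 (C ⊗_A B) ∩ C = 𝔫`: the base change `C → C ⊗_A B` of the faithfully flat `A → B` is faithfully flat.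
[cite: Matsumura1987, Thm. 7.5 (ii)] -/
theorem comap_map_eq [Module.FaithfullyFlat A B] (𝔫 : Ideal C) :
    (𝔫.map (algebraMap C (C ⊗[A] B))).comap (algebraMap C (C ⊗[A] B)) = 𝔫 :=
  Ideal.comap_map_eq_self_of_faithfullyFlat 𝔫

/-- ★ **`𝔫 (C ⊗_A B)` is prime** for a prime `𝔫 ⊇ 𝔪C` (`B` faithfully flat with `B = φ(A) + 𝔪B`): a product
`x y ∈ 𝔫 (C ⊗ B)` with `x ≡ c₁ ⊗ 1`, `y ≡ c₂ ⊗ 1` forces `c₁ c₂ ∈ 𝔫 (C ⊗ B) ∩ C = 𝔫`. [folklore] -/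
theorem isPrime_map [Module.FaithfullyFlat A B] (𝔪 : Ideal A)
    (hres : ∀ b : B, ∃ a : A, b - algebraMap A B a ∈ 𝔪.map (algebraMap A B))
    (𝔫 : Ideal C) [h𝔫p : 𝔫.IsPrime] (h𝔫 : 𝔪.map (algebraMap A C) ≤ 𝔫) :
    (𝔫.map (algebraMap C (C ⊗[A] B))).IsPrime := by
  refine Ideal.isPrime_iff.mpr ⟨?_, fun {x y} hxy => ?_⟩
  · intro htop
    apply h𝔫p.ne_top
    rw [← comap_map_eq (A := A) (B := B) 𝔫, htop, Ideal.comap_top]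
  · obtain ⟨c₁, h₁⟩ := exists_sub_algebraMap_mem 𝔪 hres 𝔫 h𝔫 x
    obtain ⟨c₂, h₂⟩ := exists_sub_algebraMap_mem 𝔪 hres 𝔫 h𝔫 y
    have hprod : algebraMap C (C ⊗[A] B) (c₁ * c₂) ∈ 𝔫.map (algebraMap C (C ⊗[A] B)) := by
      have : algebraMap C (C ⊗[A] B) (c₁ * c₂) =
          x * y - ((x - algebraMap C (C ⊗[A] B) c₁) * y +
            algebraMap C (C ⊗[A] B) c₁ * (y - algebraMap C (C ⊗[A] B) c₂)) := by
        rw [map_mul]; ring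
      rw [this]
      exact Ideal.sub_mem _ hxy (Ideal.add_mem _ (Ideal.mul_mem_right _ _ h₁) (Ideal.mul_mem_left _ _ h₂))
    have hc : c₁ * c₂ ∈ 𝔫 := by
      rw [← comap_map_eq (A := A) (B := B) 𝔫, Ideal.mem_comap]
      exact hprod
    rcases h𝔫p.mem_or_mem hc with h | h
    · left
      have := Ideal.add_mem _ h₁ (Ideal.mem_map_of_mem (algebraMap C (C ⊗[A] B)) h)
      rwa [sub_add_cancel] at this
    · right
      have := Ideal.add_mem _ h₂ (Ideal.mem_map_of_mem (algebraMap C (C ⊗[A] B)) h)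
      rwa [sub_add_cancel] at this

/-- ★ **Uniqueness**: an ideal `𝔑` of `C ⊗_A B` contracting to `𝔫 ⊇ 𝔪C` IS `𝔫 (C ⊗_A B)` (no flatness needed: `x ∈ 𝔑`
is `≡ c ⊗ 1` with `c ∈ 𝔑 ∩ C = 𝔫`). [folklore] -/
theorem eq_map_of_comap_eq (𝔪 : Ideal A)
    (hres : ∀ b : B, ∃ a : A, b - algebraMap A B a ∈ 𝔪.map (algebraMap A B))
    (𝔫 : Ideal C) (h𝔫 : 𝔪.map (algebraMap A C) ≤ 𝔫)
    {𝔑 : Ideal (C ⊗[A] B)} (h𝔑 : 𝔑.comap (algebraMap C (C ⊗[A] B)) = 𝔫) :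
    𝔑 = 𝔫.map (algebraMap C (C ⊗[A] B)) := by
  have hle : 𝔫.map (algebraMap C (C ⊗[A] B)) ≤ 𝔑 := Ideal.map_le_iff_le_comap.mpr h𝔑.ge
  refine le_antisymm (fun x hx => ?_) hle
  obtain ⟨c, hc⟩ := exists_sub_algebraMap_mem 𝔪 hres 𝔫 h𝔫 x
  have hcN : algebraMap C (C ⊗[A] B) c ∈ 𝔑 := by
    have := Ideal.sub_mem _ hx (hle hc)
    rwa [sub_sub_cancel] at this
  have hcn : c ∈ 𝔫 := by
    rw [← h𝔑, Ideal.mem_comap]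
    exact hcN
  have := Ideal.add_mem _ hc (Ideal.mem_map_of_mem (algebraMap C (C ⊗[A] B)) hcn)
  rwa [sub_add_cancel] at this

/-- ★ **The fibre of `Spec (C ⊗_A B) → Spec C` over a prime `𝔫 ⊇ 𝔪C` is ONE point**: there is exactly one prime of
`C ⊗_A B` contracting to `𝔫`, namely `𝔫 (C ⊗_A B)`. [cite: StacksProject, Tag 0C4G] [folklore] -/
theorem existsUnique_isPrime_comap_eq [Module.FaithfullyFlat A B] (𝔪 : Ideal A)
    (hres : ∀ b : B, ∃ a : A, b - algebraMap A B a ∈ 𝔪.map (algebraMap A B))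
    (𝔫 : Ideal C) [𝔫.IsPrime] (h𝔫 : 𝔪.map (algebraMap A C) ≤ 𝔫) :
    ∃! 𝔑 : Ideal (C ⊗[A] B), 𝔑.IsPrime ∧ 𝔑.comap (algebraMap C (C ⊗[A] B)) = 𝔫 := by
  refine ⟨𝔫.map (algebraMap C (C ⊗[A] B)), ⟨isPrime_map 𝔪 hres 𝔫 h𝔫, comap_map_eq 𝔫⟩, ?_⟩
  rintro 𝔑 ⟨-, h𝔑⟩
  exact eq_map_of_comap_eq 𝔪 hres 𝔫 h𝔫 h𝔑

/-! ## §3 The residue condition and unramifiedness at the localizations -/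

/-- **The residue condition localises at a PRIME.** For `f : R → S`, primes `P ⊆ S` over `p ⊆ R` and `S = f(R) + P`,
every `d ∈ S_P` is `≡ ℓ(c) mod 𝔪_{S_P}` for some `c ∈ R_p`, `ℓ = Localization.localRingHom p P f`: for `d = x/s` with
`x ≡ f c₁`, `s ≡ f c₂`, take `c = c₁/c₂` (`x·f c₂ - f c₁·s ∈ P`). [cite: StacksProject, Tag 02G8] [folklore] -/
theorem forall_exists_sub_localRingHom_mem_of_prime {R S : Type} [CommRing R] [CommRing S] (f : R →+* S)
    (p : Ideal R) [p.IsPrime] (P : Ideal S) [P.IsPrime] (hP : p = P.comap f)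
    (hsurj : ∀ s : S, ∃ r : R, s - f r ∈ P) :
    ∀ d : Localization.AtPrime P, ∃ c : Localization.AtPrime p,
      d - Localization.localRingHom p P f hP c ∈ maximalIdeal (Localization.AtPrime P) := by
  intro d
  obtain ⟨⟨x, s⟩, rfl⟩ := IsLocalization.mk'_surjective P.primeCompl d
  obtain ⟨c₁, h₁⟩ := hsurj x
  obtain ⟨c₂, h₂⟩ := hsurj (s : S)
  have hfc₂ : f c₂ ∈ P.primeCompl := by
    rw [Ideal.mem_primeCompl_iff]
    intro hmem
    apply Ideal.mem_primeCompl_iff.mp s.2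
    have := Ideal.add_mem _ h₂ hmem
    rwa [sub_add_cancel] at this
  have hc₂ : c₂ ∈ p.primeCompl := by
    rw [Ideal.mem_primeCompl_iff]
    intro hc₂p
    rw [hP, Ideal.mem_comap] at hc₂p
    exact Ideal.mem_primeCompl_iff.mp hfc₂ hc₂p
  refine ⟨IsLocalization.mk' (Localization.AtPrime p) c₁ ⟨c₂, hc₂⟩, ?_⟩
  rw [Localization.localRingHom_mk']
  have hsub : IsLocalization.mk' (Localization.AtPrime P) x s -
      IsLocalization.mk' (Localization.AtPrime P) (f c₁) (⟨f c₂, hfc₂⟩ : P.primeCompl) =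
      IsLocalization.mk' (Localization.AtPrime P) (x * f c₂ - f c₁ * s)
        (s * (⟨f c₂, hfc₂⟩ : P.primeCompl)) := by
    rw [IsLocalization.eq_mk'_iff_mul_eq, sub_mul, Submonoid.coe_mul, map_mul, map_sub, map_mul, map_mul,
      ← mul_assoc, IsLocalization.mk'_spec, mul_comm (algebraMap S (Localization.AtPrime P) (s : S))
        (algebraMap S (Localization.AtPrime P) (f c₂)), ← mul_assoc, IsLocalization.mk'_spec]
  rw [hsub, IsLocalization.AtPrime.mk'_mem_maximal_iff (Localization.AtPrime P) P]
  have : x * f c₂ - f c₁ * (s : S) = (x - f c₁) * f c₂ - f c₁ * ((s : S) - f c₂) := by ring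
  rw [this]
  exact Ideal.sub_mem _ (Ideal.mul_mem_right _ _ h₁) (Ideal.mul_mem_left _ _ h₂)

/-- **Unramified at the localization**: for a prime `𝔑` of `C ⊗_A B` over `𝔫 ⊇ 𝔪C`,
`𝔫 · (C ⊗_A B)_𝔑 = 𝔪_{(C ⊗_A B)_𝔑}` (as `𝔑 = 𝔫 (C ⊗_A B)`). [cite: StacksProject, Tag 02G8] [folklore] -/
theorem map_eq_maximalIdeal_localization (𝔪 : Ideal A)
    (hres : ∀ b : B, ∃ a : A, b - algebraMap A B a ∈ 𝔪.map (algebraMap A B))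
    (𝔫 : Ideal C) (h𝔫 : 𝔪.map (algebraMap A C) ≤ 𝔫)
    (𝔑 : Ideal (C ⊗[A] B)) [𝔑.IsPrime] (h𝔑 : 𝔑.comap (algebraMap C (C ⊗[A] B)) = 𝔫) :
    𝔫.map (algebraMap C (Localization.AtPrime 𝔑)) = maximalIdeal (Localization.AtPrime 𝔑) := by
  have h5 : 𝔑 = 𝔫.map (algebraMap C (C ⊗[A] B)) := eq_map_of_comap_eq 𝔪 hres 𝔫 h𝔫 h𝔑
  rw [← Localization.AtPrime.map_eq_maximalIdeal,
    IsScalarTower.algebraMap_eq C (C ⊗[A] B) (Localization.AtPrime 𝔑), ← Ideal.map_map, ← h5]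

/-! ## §4 The completions agree -/

/-- ★★ **`(C_𝔫)^ ≅ ((C ⊗_A B)_𝔑)^`.** Let `A → B` be faithfully flat with `B = φ(A) + 𝔪B` for an ideal `𝔪 ⊆ A`, `C` an
`A`-algebra, `𝔫 ⊇ 𝔪C` a prime of `C` and `𝔑` a prime of `C ⊗_A B` over `𝔫` (there is exactly one,
`existsUnique_isPrime_comap_eq`). Then the local homomorphism `ℓ : C_𝔫 → (C ⊗_A B)_𝔑` is flat, unramified with trivial
residue extension, hence induces an isomorphism of the adic completions `e` with `e(ĉ) = (ℓ c)^`.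
[cite: Matsumura1987, Thm. 8.4; Thm. 8.14; Thm. 22.4 (i)] [cite: StacksProject, Tag 0C4G] -/
theorem exists_ringEquiv_adicCompletion [Module.FaithfullyFlat A B] (𝔪 : Ideal A)
    (hres : ∀ b : B, ∃ a : A, b - algebraMap A B a ∈ 𝔪.map (algebraMap A B))
    (𝔫 : Ideal C) [𝔫.IsPrime] (h𝔫 : 𝔪.map (algebraMap A C) ≤ 𝔫)
    (𝔑 : Ideal (C ⊗[A] B)) [𝔑.IsPrime] (h𝔑 : 𝔑.comap (algebraMap C (C ⊗[A] B)) = 𝔫) :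
    ∃ e : AdicCompletion (maximalIdeal (Localization.AtPrime 𝔫)) (Localization.AtPrime 𝔫) ≃+*
        AdicCompletion (maximalIdeal (Localization.AtPrime 𝔑)) (Localization.AtPrime 𝔑),
      ∀ c : Localization.AtPrime 𝔫,
        e (algebraMap (Localization.AtPrime 𝔫) _ c) =
          algebraMap (Localization.AtPrime 𝔑) _
            (Localization.localRingHom 𝔫 𝔑 (algebraMap C (C ⊗[A] B)) h𝔑.symm c) := by
  have hunr := map_eq_maximalIdeal_localization 𝔪 hres 𝔫 h𝔫 𝔑 h𝔑
  have hle : 𝔫.map (algebraMap C (C ⊗[A] B)) ≤ 𝔑 := Ideal.map_le_iff_le_comap.mpr h𝔑.ge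
  have hresloc := forall_exists_sub_localRingHom_mem_of_prime (algebraMap C (C ⊗[A] B)) 𝔫 𝔑 h𝔑.symm
    (fun s => by
      obtain ⟨r, hr⟩ := exists_sub_algebraMap_mem 𝔪 hres 𝔫 h𝔫 s
      exact ⟨r, hle hr⟩)
  set ℓ := Localization.localRingHom 𝔫 𝔑 (algebraMap C (C ⊗[A] B)) h𝔑.symm with hℓ
  have hflat : ℓ.Flat :=
    RingHom.Flat.localRingHom (f := algebraMap C (C ⊗[A] B)) (RingHom.flat_algebraMap_iff.mpr inferInstance)
      𝔑 𝔫 h𝔑.symm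
  letI : Algebra (Localization.AtPrime 𝔫) (Localization.AtPrime 𝔑) := ℓ.toAlgebra
  haveI : Module.Flat (Localization.AtPrime 𝔫) (Localization.AtPrime 𝔑) := hflat
  haveI : IsLocalHom (algebraMap (Localization.AtPrime 𝔫) (Localization.AtPrime 𝔑)) :=
    Localization.isLocalHom_localRingHom 𝔫 𝔑 (algebraMap C (C ⊗[A] B)) h𝔑.symm
  obtain ⟨e, -, he⟩ := CompletionOfFlatUnramified.exists_ringEquiv_adicCompletion_of_flat
    (A := Localization.AtPrime 𝔫) (B := Localization.AtPrime 𝔑)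
    (CompletionOfFlatUnramifiedAtPrime.map_maximalIdeal_localRingHom_eq 𝔫 𝔑 h𝔑 hunr) hresloc
  exact ⟨e, fun c => he c⟩

/-- The same with the prime UPSTAIRS produced rather than given: there is a prime `𝔑` of `C ⊗_A B` over `𝔫` — unique by
`existsUnique_isPrime_comap_eq` — with `(C_𝔫)^ ≅ ((C ⊗_A B)_𝔑)^` over `ℓ`. [cite: Matsumura1987, Thm. 8.14] -/
theorem exists_prime_ringEquiv_adicCompletion [Module.FaithfullyFlat A B] (𝔪 : Ideal A)
    (hres : ∀ b : B, ∃ a : A, b - algebraMap A B a ∈ 𝔪.map (algebraMap A B))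
    (𝔫 : Ideal C) [𝔫.IsPrime] (h𝔫 : 𝔪.map (algebraMap A C) ≤ 𝔫) :
    ∃ (𝔑 : Ideal (C ⊗[A] B)) (_ : 𝔑.IsPrime) (h𝔑 : 𝔑.comap (algebraMap C (C ⊗[A] B)) = 𝔫),
      ∃ e : AdicCompletion (maximalIdeal (Localization.AtPrime 𝔫)) (Localization.AtPrime 𝔫) ≃+*
          AdicCompletion (maximalIdeal (Localization.AtPrime 𝔑)) (Localization.AtPrime 𝔑),
        ∀ c : Localization.AtPrime 𝔫,
          e (algebraMap (Localization.AtPrime 𝔫) _ c) =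
            algebraMap (Localization.AtPrime 𝔑) _
              (Localization.localRingHom 𝔫 𝔑 (algebraMap C (C ⊗[A] B)) h𝔑.symm c) := by
  haveI := isPrime_map (B := B) 𝔪 hres 𝔫 h𝔫
  exact ⟨𝔫.map (algebraMap C (C ⊗[A] B)), inferInstance, comap_map_eq 𝔫,
    exists_ringEquiv_adicCompletion 𝔪 hres 𝔫 h𝔫 _ (comap_map_eq 𝔫)⟩

/-! ## §5 The case `B = Â` -/

/-- `Â = A + 𝔪_A Â` for a Noetherian local ring `A` (`κ(A) = κ(Â)` and `𝔪_Â = 𝔪_A Â`, Mathlib).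
[cite: Matsumura1987, Thm. 8.14] -/
theorem forall_exists_sub_mem_adicCompletion (A : Type) [CommRing A] [IsLocalRing A] [IsNoetherianRing A] :
    ∀ b : AdicCompletion (maximalIdeal A) A, ∃ a : A,
      b - algebraMap A (AdicCompletion (maximalIdeal A) A) a ∈
        (maximalIdeal A).map (algebraMap A (AdicCompletion (maximalIdeal A) A)) := by
  intro b
  rw [← AdicCompletion.maximalIdeal_eq_map]
  exact CompletionOfFlatUnramified.forall_exists_sub_mem_of_residueField_surjective
    (AdicCompletion.residueField_map_bijective A).2 b

/-- **The case `B = Â`, fibre**: for a Noetherian local ring `A`, an `A`-algebra `C` and a prime `𝔫 ⊇ 𝔪_A C` of `C`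
there is EXACTLY ONE prime of `C ⊗_A Â` over `𝔫` (namely `𝔫 (C ⊗_A Â)`). (With `C` a chart ring of `Bl_J(Spec A)`: the
points of `Bl_{JÂ}(Spec Â) = Bl_J(Spec A) ⊗_A Â` over `V(𝔪̂)` correspond bijectively to those of `Bl_J(Spec A)` over
`V(𝔪)`.) [cite: Matsumura1987, Thm. 8.14] [cite: StacksProject, Tag 0C4G] -/
theorem existsUnique_isPrime_comap_eq_adicCompletion (A : Type) [CommRing A] [IsLocalRing A]
    [IsNoetherianRing A] (C : Type) [CommRing C] [Algebra A C]
    (𝔫 : Ideal C) [𝔫.IsPrime] (h𝔫 : (maximalIdeal A).map (algebraMap A C) ≤ 𝔫) :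
    ∃! 𝔑 : Ideal (C ⊗[A] AdicCompletion (maximalIdeal A) A),
      𝔑.IsPrime ∧ 𝔑.comap (algebraMap C (C ⊗[A] AdicCompletion (maximalIdeal A) A)) = 𝔫 := by
  haveI : Module.FaithfullyFlat A (AdicCompletion (maximalIdeal A) A) :=
    Module.FaithfullyFlat.of_flat_of_isLocalHom
  exact existsUnique_isPrime_comap_eq (maximalIdeal A) (forall_exists_sub_mem_adicCompletion A) 𝔫 h𝔫

/-! ## §6 Regularity and the singular points over `V(𝔪)` are read off on either side (appended) -/
/-- ★★ **Regularity agrees** (Noetherian case): for a prime `𝔑` of `C ⊗_A B` over `𝔫 ⊇ 𝔪C`, `C_𝔫` is regular iff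
`(C ⊗_A B)_𝔑` is — same completion, and regularity is decided by the completion. [cite: Matsumura1987, Thm. 8.14; §19 p. 158] -/
theorem isRegularLocalRing_iff [Module.FaithfullyFlat A B] [IsNoetherianRing C] [IsNoetherianRing (C ⊗[A] B)]
    (𝔪 : Ideal A) (hres : ∀ b : B, ∃ a : A, b - algebraMap A B a ∈ 𝔪.map (algebraMap A B))
    (𝔫 : Ideal C) [𝔫.IsPrime] (h𝔫 : 𝔪.map (algebraMap A C) ≤ 𝔫)
    (𝔑 : Ideal (C ⊗[A] B)) [𝔑.IsPrime] (h𝔑 : 𝔑.comap (algebraMap C (C ⊗[A] B)) = 𝔫) :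
    IsRegularLocalRing (Localization.AtPrime 𝔫) ↔ IsRegularLocalRing (Localization.AtPrime 𝔑) := by
  haveI : IsNoetherianRing (Localization.AtPrime 𝔫) :=
    IsLocalization.isNoetherianRing 𝔫.primeCompl (Localization.AtPrime 𝔫) inferInstance
  haveI : IsNoetherianRing (Localization.AtPrime 𝔑) :=
    IsLocalization.isNoetherianRing 𝔑.primeCompl (Localization.AtPrime 𝔑) inferInstance
  obtain ⟨e, -⟩ := exists_ringEquiv_adicCompletion 𝔪 hres 𝔫 h𝔫 𝔑 h𝔑
  constructor
  · intro h
    haveI := isRegularLocalRing_adicCompletion (Localization.AtPrime 𝔫)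
    exact isRegularLocalRing_of_adicCompletion_equiv rfl e.symm
  · intro h
    haveI := isRegularLocalRing_adicCompletion (Localization.AtPrime 𝔑)
    exact isRegularLocalRing_of_adicCompletion_equiv rfl e

/-- ★ **`Spec (C ⊗_A B) → Spec C` is a bijection over `V(𝔪C)`** (`B` faithfully flat, `B = φ(A) + 𝔪B`).
[cite: StacksProject, Tag 0C4G] [folklore] -/
theorem comap_bijOn [Module.FaithfullyFlat A B] (𝔪 : Ideal A)
    (hres : ∀ b : B, ∃ a : A, b - algebraMap A B a ∈ 𝔪.map (algebraMap A B)) :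
    Set.BijOn (PrimeSpectrum.comap (algebraMap C (C ⊗[A] B)))
      {𝔑 : PrimeSpectrum (C ⊗[A] B) | 𝔪.map (algebraMap A C) ≤ 𝔑.asIdeal.comap (algebraMap C (C ⊗[A] B))}
      {𝔫 : PrimeSpectrum C | 𝔪.map (algebraMap A C) ≤ 𝔫.asIdeal} := by
  refine ⟨fun 𝔑 h𝔑 => ?_, fun 𝔑₁ h₁ 𝔑₂ h₂ h12 => ?_, fun 𝔫 h𝔫 => ?_⟩
  · simpa only [Set.mem_setOf_eq, PrimeSpectrum.comap_asIdeal] using h𝔑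
  · have e₁ := eq_map_of_comap_eq (B := B) 𝔪 hres (𝔑₁.asIdeal.comap (algebraMap C (C ⊗[A] B))) h₁ rfl
    have e₂ := eq_map_of_comap_eq (B := B) 𝔪 hres (𝔑₂.asIdeal.comap (algebraMap C (C ⊗[A] B))) h₂ rfl
    have h12' : 𝔑₁.asIdeal.comap (algebraMap C (C ⊗[A] B)) = 𝔑₂.asIdeal.comap (algebraMap C (C ⊗[A] B)) := by
      simpa only [PrimeSpectrum.ext_iff, PrimeSpectrum.comap_asIdeal] using h12
    ext1
    rw [e₁, e₂, h12']
  · haveI := 𝔫.isPrime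
    haveI := isPrime_map (B := B) 𝔪 hres 𝔫.asIdeal h𝔫
    refine ⟨⟨𝔫.asIdeal.map (algebraMap C (C ⊗[A] B)), inferInstance⟩, ?_, ?_⟩
    · change 𝔪.map (algebraMap A C) ≤ (𝔫.asIdeal.map (algebraMap C (C ⊗[A] B))).comap (algebraMap C (C ⊗[A] B))
      rw [comap_map_eq]
      exact h𝔫
    · ext1
      rw [PrimeSpectrum.comap_asIdeal]
      exact comap_map_eq 𝔫.asIdeal

/-- ★★ **The non-regular primes over `V(𝔪)` correspond** (Noetherian case) under `Spec (C ⊗_A B) → Spec C`.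
[cite: Matsumura1987, Thm. 8.14; §19 p. 158] [cite: StacksProject, Tag 0C4G] -/
theorem comap_bijOn_not_isRegularLocalRing [Module.FaithfullyFlat A B] [IsNoetherianRing C]
    [IsNoetherianRing (C ⊗[A] B)] (𝔪 : Ideal A)
    (hres : ∀ b : B, ∃ a : A, b - algebraMap A B a ∈ 𝔪.map (algebraMap A B)) :
    Set.BijOn (PrimeSpectrum.comap (algebraMap C (C ⊗[A] B)))
      {𝔑 : PrimeSpectrum (C ⊗[A] B) | 𝔪.map (algebraMap A C) ≤ 𝔑.asIdeal.comap (algebraMap C (C ⊗[A] B)) ∧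
        ¬ IsRegularLocalRing (Localization.AtPrime 𝔑.asIdeal)}
      {𝔫 : PrimeSpectrum C | 𝔪.map (algebraMap A C) ≤ 𝔫.asIdeal ∧
        ¬ IsRegularLocalRing (Localization.AtPrime 𝔫.asIdeal)} := by
  have hbij := comap_bijOn (B := B) (C := C) 𝔪 hres
  refine ⟨fun 𝔑 h𝔑 => ?_, fun 𝔑₁ h₁ 𝔑₂ h₂ h12 => hbij.injOn h₁.1 h₂.1 h12, fun 𝔫 h𝔫 => ?_⟩
  · refine ⟨hbij.mapsTo h𝔑.1, fun hreg => h𝔑.2 ?_⟩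
    rw [Set.mem_setOf_eq] at h𝔑
    have hiff := isRegularLocalRing_iff 𝔪 hres (𝔑.asIdeal.comap (algebraMap C (C ⊗[A] B))) h𝔑.1 𝔑.asIdeal rfl
    exact hiff.mp hreg
  · obtain ⟨𝔑, h𝔑, h𝔑𝔫⟩ := hbij.surjOn h𝔫.1
    refine ⟨𝔑, ⟨h𝔑, fun hreg => h𝔫.2 ?_⟩, h𝔑𝔫⟩
    have h𝔑𝔫' : 𝔑.asIdeal.comap (algebraMap C (C ⊗[A] B)) = 𝔫.asIdeal := by
      rw [← PrimeSpectrum.comap_asIdeal, h𝔑𝔫]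
    haveI := 𝔫.isPrime
    have hiff := isRegularLocalRing_iff 𝔪 hres 𝔫.asIdeal h𝔫.1 𝔑.asIdeal h𝔑𝔫'
    exact hiff.mpr hreg

/-- ★★ **Finiteness of the singular points over `V(𝔪)` transfers from `C` to `C ⊗_A B`.** [cite: Matsumura1987, Thm. 8.14] -/
theorem finite_not_isRegularLocalRing_of_finite [Module.FaithfullyFlat A B] [IsNoetherianRing C]
    [IsNoetherianRing (C ⊗[A] B)] (𝔪 : Ideal A)
    (hres : ∀ b : B, ∃ a : A, b - algebraMap A B a ∈ 𝔪.map (algebraMap A B))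
    (hfin : {𝔫 : PrimeSpectrum C | 𝔪.map (algebraMap A C) ≤ 𝔫.asIdeal ∧
      ¬ IsRegularLocalRing (Localization.AtPrime 𝔫.asIdeal)}.Finite) :
    {𝔑 : PrimeSpectrum (C ⊗[A] B) | 𝔪.map (algebraMap A C) ≤ 𝔑.asIdeal.comap (algebraMap C (C ⊗[A] B)) ∧
      ¬ IsRegularLocalRing (Localization.AtPrime 𝔑.asIdeal)}.Finite := by
  have hbij := comap_bijOn_not_isRegularLocalRing (B := B) (C := C) 𝔪 hres
  refine Set.Finite.of_finite_image ?_ hbij.injOn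
  rw [hbij.image_eq]
  exact hfin

end Summit.ResolutionOfSingularities.ResolutionOfSingularities.Theorems.FRationalResolution.CompletedBaseChangeFibre

end
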